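import Summits.BirchSwinnertonDyer.BirchSwinnertonDyer.Theorems.GenusKolyvaginAtTwoGenusPrimitiveSupplyAtTwoTwistRamifiedTorsion
import Summits.BirchSwinnertonDyer.BirchSwinnertonDyer.Theorems.GenusKolyvaginAtTwoGenusPrimitiveSupplyAtTwoTwistLocalConditionPlaces
import Literature.NumberTheory.EllipticCurves.LocalKummerMap
import HarnessLib

/-!
# Route `GenusKolyvaginAtTwo`, crux #2 `GenusPrimitiveSupplyAtTwo` (stmt-BirchSwinnertonDyer-22136):
# towards Mazur–Rubin Lemma 2.11, step two — at a good odd place ramified in `K(√d)` the local Kummer condition of the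
# twist is the image of its `K_v`-RATIONAL `2`-TORSION

Width seat `bsd-line-gk2-p5` g8 (cell `bsd-f1-sign2`, SUPPLY lineage), eighth file of the series (crux workfile
`Lines/genus-supply-mr-instantiation.md`). THEOREMS ONLY (no definition, no named fact, no `sorry`); helper
`--supports stmt-BirchSwinnertonDyer-22136`; no item is closed; BSD is not proved by any of this.

WHAT. `exists_twoTorsion_localKummerMap_eq`: for `W/K` elliptic, `Wd = C • W^{(d)}` elliptic, a finite place `v ∤ 2` of GOOD reduction
for `W` that is RAMIFIED in `K(√d)` (`ι(√d) ∉ K_v^{nr}`), every class of the local Kummer condition `𝓛_{Wd,K_v}` is the local Kummer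
class of a `K_v`-rational point `T` of `Wd` with `2T = 0`. Proof (Mazur–Rubin, proof of Lemma 2.11): `Wd(K_v)` has no point of order
`4` (`two_zsmul_eq_zero_of_fixed_of_four_zsmul_eq_zero`, p621520), so the local Kummer map is INJECTIVE on `Wd(K_v)[2]` (its kernel
is `2·Wd(K_v)`, `ker_localKummerMap`); its image there has `#Wd(K_v)[2]` elements, which is `#𝓛_{Wd,K_v} = #Wd(K_v)[2]·#(𝓞_v/2)`
(Mazur–Rubin Lemma 2.2 = tree `natCard_kummerLocalConditionAt_adicCompletion`, `#(𝓞_v/2) = 1`), so it is all of `𝓛` (finite).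

References: [MazurRubin2010] Lemma 2.2, Lemma 2.11; [MilneADT2006] I Lemma 3.3; [SilvermanAEC2009] VIII.§2, X.§4.
-/

set_option linter.dupNamespace false -- tree convention: `Summit.BirchSwinnertonDyer.BirchSwinnertonDyer.Theorems` (summit = sub-problem)
set_option autoImplicit false

noncomputable section

open scoped Classical

namespace Summit.BirchSwinnertonDyer.BirchSwinnertonDyer.Theorems.GenusKolyTwistLocal

open WeierstrassCurve Field NumberField IsDedekindDomain Function
open Literature.NumberTheory.EllipticCurves Literature.NumberTheory.GaloisRepresentations
open Literature.NumberTheory.GaloisRepresentations.IsNonarchimedeanLocalField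

variable {K : Type} [Field K] [NumberField K] (W Wd : WeierstrassCurve K) [W.IsElliptic] [Wd.IsElliptic]
  (v : HeightOneSpectrum (𝓞 K))

/-! ## §20 `𝓛_{Wd,K_v}` is the image of `Wd(K_v)[2]` at a ramified good odd place -/

omit [Wd.IsElliptic] in
/-- **No `K_v`-rational point of order `4` on the twist** (rational form of p621520's §19): at a good place `v ∤ 2` of `W`
ramified in `K(√d)`, a `K_v`-rational point `P` of `Wd = C • W^{(d)}` with `4P = 0` has `2P = 0`. [cite: MazurRubin2010, Lemma 2.11] -/
theorem two_nsmul_eq_zero_of_four_nsmul_eq_zero {d : K} (hd : d ≠ 0) {C : VariableChange K}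
    (hWd : C • W.quadraticTwist d = Wd) (hv : W.HasGoodReductionAt v) (h2v : ((2 : ℕ) : 𝓞 K) ∉ v.asIdeal)
    (hram : closureEmb (K := K) (v.adicCompletion K) (geomSqrt d) ∉ maxUnramified (v.adicCompletion K))
    {P : (Wd.baseChange (v.adicCompletion K)).toAffine.Point} (h4 : 4 • P = 0) : 2 • P = 0 := by
  set Q : localPoints Wd (v.adicCompletion K) :=
    Wd.baseChangeGeomPointsEquiv (v.adicCompletion K) (toGeomPoints (Wd.baseChange (v.adicCompletion K)) P)
    with hQdef
  have hQfix : ∀ σ : absoluteGaloisGroup (v.adicCompletion K), σ • Q = Q := fun σ ↦ by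
    rw [hQdef, ← baseChangeGeomPointsEquiv_smul, smul_toGeomPoints]
  have h4' : ((2 ^ 2 : ℕ) : ℤ) • P = 0 := by
    rw [show ((2 ^ 2 : ℕ) : ℤ) = ((4 : ℕ) : ℤ) by norm_num, natCast_zsmul, h4]
  have hQ4 : ((2 ^ 2 : ℕ) : ℤ) • Q = 0 := by
    rw [hQdef, ← map_zsmul, ← map_zsmul, h4', map_zero, map_zero]
  have h2Q := two_zsmul_eq_zero_of_fixed_of_four_zsmul_eq_zero W Wd v hd hWd hv h2v hram hQfix hQ4
  rw [hQdef, ← map_zsmul, ← map_zsmul, AddEquiv.map_eq_zero_iff,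
    map_eq_zero_iff _ (toGeomPoints_injective _)] at h2Q
  rw [← natCast_zsmul]
  exact h2Q

/-- **`𝓛_{Wd,K_v} = κ(Wd(K_v)[2])`** at a good place `v ∤ 2` of `W` ramified in `K(√d)`: every class of the local `2`-Kummer
condition of the twist `Wd = C • W^{(d)}` is the local Kummer class of a `K_v`-RATIONAL `2`-torsion point (the local Kummer map is
injective on `Wd(K_v)[2]` — no rational `4`-torsion — and `#𝓛 = #Wd(K_v)[2]` by Mazur–Rubin Lemma 2.2, tree
`natCard_kummerLocalConditionAt_adicCompletion`). [cite: MazurRubin2010, Lemma 2.2 and Lemma 2.11] [cite: MilneADT2006, I Lemma 3.3] -/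
theorem exists_twoTorsion_localKummerMap_eq {d : K} (hd : d ≠ 0) {C : VariableChange K}
    (hWd : C • W.quadraticTwist d = Wd) (hv : W.HasGoodReductionAt v) (h2v : ((2 : ℕ) : 𝓞 K) ∉ v.asIdeal)
    (hram : closureEmb (K := K) (v.adicCompletion K) (geomSqrt d) ∉ maxUnramified (v.adicCompletion K))
    {c : galoisCohomology (GaloisRep.restrictField (v.adicCompletion K) (Wd.torsionGaloisModule ((2 : ℕ) : ℤ))) 1}
    (hc : c ∈ Wd.kummerLocalConditionAt ((2 : ℕ) : ℤ) (v.adicCompletion K)) :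
    ∃ T : (Wd.baseChange (v.adicCompletion K)).toAffine.Point, 2 • T = 0 ∧
      Wd.localKummerMap (v.adicCompletion K) (n := ((2 : ℕ) : ℤ)) (by norm_num) T = c := by
  haveI : CharZero (v.adicCompletion K) := Literature.NumberTheory.GaloisRepresentations.charZero_adicCompletion v
  have hn : (((2 : ℕ) : ℤ)) ≠ 0 := by norm_num
  set κ := Wd.localKummerMap (v.adicCompletion K) (n := ((2 : ℕ) : ℤ)) hn with hκ
  set Tor : AddSubgroup (Wd.baseChange (v.adicCompletion K)).toAffine.Point :=
    (nsmulAddMonoidHom 2 : (Wd.baseChange (v.adicCompletion K)).toAffine.Point →+ _).ker with hTor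
  -- `κ` is injective on the rational `2`-torsion
  have hinj : Function.Injective (κ.comp Tor.subtype) := by
    rw [injective_iff_map_eq_zero]
    rintro ⟨T, hT⟩ hT0
    rw [AddMonoidHom.coe_comp, Function.comp_apply, AddSubgroup.coe_subtype] at hT0
    have hker : T ∈ κ.ker := hT0
    rw [hκ, Wd.ker_localKummerMap (v.adicCompletion K) hn] at hker
    obtain ⟨P', hP'⟩ := hker
    rw [zsmulAddGroupHom_apply] at hP'
    have hT2 : 2 • T = 0 := hT
    have h4 : 4 • P' = 0 := by
      rw [show (4 : ℕ) • P' = 2 • ((((2 : ℕ) : ℤ)) • P') by rw [natCast_zsmul, ← mul_nsmul], hP', hT2]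
    have h2 := two_nsmul_eq_zero_of_four_nsmul_eq_zero W Wd v hd hWd hv h2v hram h4
    apply Subtype.ext
    change T = 0
    rw [← hP', natCast_zsmul, h2]
  -- counting: `#κ(Tor) = #Tor = #𝓛`
  have hrange : (κ.comp Tor.subtype).range = Tor.map κ := by
    rw [AddMonoidHom.range_comp, AddSubgroup.range_subtype]
  have hle : Tor.map κ ≤ Wd.kummerLocalConditionAt ((2 : ℕ) : ℤ) (v.adicCompletion K) := by
    rw [← Wd.range_localKummerMap (v.adicCompletion K) hn]
    exact AddSubgroup.map_le_range _ _
  haveI hfin : Finite (Wd.kummerLocalConditionAt ((2 : ℕ) : ℤ) (v.adicCompletion K)) :=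
    Wd.finite_kummerLocalConditionAt_adicCompletion v (n := 2) two_ne_zero
  have hcard : Nat.card (Wd.kummerLocalConditionAt ((2 : ℕ) : ℤ) (v.adicCompletion K)) ≤ Nat.card (Tor.map κ) := by
    rw [Wd.natCard_kummerLocalConditionAt_adicCompletion v (n := 2) two_ne_zero,
      natCard_quotient_span_natCast_eq_one_of_not_mem v h2v, mul_one, ← hrange,
      ← Nat.card_congr (AddMonoidHom.ofInjective hinj).toEquiv]
  have heq : Tor.map κ = Wd.kummerLocalConditionAt ((2 : ℕ) : ℤ) (v.adicCompletion K) :=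
    AddSubgroup.eq_of_le_of_card_ge hle hcard
  rw [← heq] at hc
  obtain ⟨T, hT, rfl⟩ := hc
  exact ⟨T, hT, rfl⟩

end Summit.BirchSwinnertonDyer.BirchSwinnertonDyer.Theorems.GenusKolyTwistLocal

end
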